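import Mathlib

/-!
# `FiveTermTransfer` (stmt-KontsevichZagierPeriods-3469) — line `valuation-kernel-sweep`,
stub `stub_circuitCore`

The circuit lemma for five vectors of `ℝ⁴` in determinant (Cramer) form: the two
triangulations of a circuit of five points tile the same region, stated as the vanishing of a
signed sum of open-cone indicators. Pure linear algebra. [folklore]
-/

noncomputable section

namespace Summit.KontsevichZagierPeriods.HyperbolicBloch.FiveTerm

open Finset Matrix

/-! ## Linear algebra: dependence, Cramer coordinates, uniqueness, line of representations -/

/-- The signed maximal minors `(-1)^i D i` of a `5 × 4` matrix give a linear dependence of its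
five rows (Laplace expansion of a `5 × 5` determinant with a repeated column). [folklore] -/
theorem circuit_dependence (v : Fin 5 → Fin 4 → ℝ) (b : Fin 4) :
    ∑ i : Fin 5, (-1 : ℝ) ^ (i : ℕ) * (Matrix.of fun a c => v (i.succAbove a) c).det * v i b
      = 0 := by
  let M : Matrix (Fin 5) (Fin 5) ℝ := Matrix.of fun i => Fin.cons (v i b) (v i)
  have h0 : M.det = 0 :=
    Matrix.det_zero_of_column_eq (i := 0) (j := b.succ) (Fin.succ_ne_zero b).symm
      (fun k => by simp [M])
  have h1 : M.det = ∑ i : Fin 5,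
      (-1 : ℝ) ^ (i : ℕ) * (Matrix.of fun a c => v (i.succAbove a) c).det * v i b := by
    rw [Matrix.det_succ_column_zero]
    refine Finset.sum_congr rfl fun i _ => ?_
    have hsub : M.submatrix i.succAbove Fin.succ = Matrix.of fun a c => v (i.succAbove a) c := by
      ext a c
      simp [M]
    rw [hsub]
    simp only [M, Matrix.of_apply, Fin.cons_zero]
    ring
  rw [← h1]
  exact h0

/-- Cramer's rule: if `D j ≠ 0`, the coordinates of `Q` in the basis of the four rows other
than `j` are `E j a / D j`. [folklore] -/
theorem circuit_cramer (v : Fin 5 → Fin 4 → ℝ) (Q : Fin 4 → ℝ) (D : Fin 5 → ℝ)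
    (E : Fin 5 → Fin 4 → ℝ)
    (hD : ∀ j, D j = (Matrix.of fun a b => v (j.succAbove a) b).det)
    (hE : ∀ j a, E j a = ((Matrix.of fun a' b => v (j.succAbove a') b).updateRow a Q).det)
    {j : Fin 5} (hj : D j ≠ 0) (b : Fin 4) :
    Q b = ∑ a : Fin 4, E j a / D j * v (j.succAbove a) b := by
  have h := congrFun (Matrix.mulVec_cramer (Matrix.of fun a' c => v (j.succAbove a') c)ᵀ Q) b
  rw [Matrix.det_transpose, ← hD j] at h
  simp only [Matrix.mulVec, dotProduct, Matrix.transpose_apply, Matrix.cramer_transpose_apply,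
    Matrix.of_apply, ← hE j, Pi.smul_apply, smul_eq_mul] at h
  have h' : Q b = (∑ a : Fin 4, v (j.succAbove a) b * E j a) / D j := by
    rw [eq_div_iff hj, h, mul_comm]
  rw [h', Finset.sum_div]
  exact Finset.sum_congr rfl fun a _ => by ring

/-- Coordinates with respect to the four rows other than `j` are unique when `D j ≠ 0`
(coefficient vectors indexed by `Fin 5` with vanishing `j`-th entry). [folklore] -/
theorem circuit_unique (v : Fin 5 → Fin 4 → ℝ) (D : Fin 5 → ℝ)
    (hD : ∀ j, D j = (Matrix.of fun a b => v (j.succAbove a) b).det)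
    {j : Fin 5} (hj : D j ≠ 0) {f g : Fin 5 → ℝ} (hf : f j = 0) (hg : g j = 0)
    (h : ∀ b, ∑ i, f i * v i b = ∑ i, g i * v i b) : f = g := by
  have hdet : (Matrix.of fun a b => v (j.succAbove a) b).det ≠ 0 := fun h0 => hj ((hD j).trans h0)
  have key : (fun a => f (j.succAbove a) - g (j.succAbove a)) ᵥ*
      (Matrix.of fun a b => v (j.succAbove a) b) = 0 := by
    ext b
    have hb := h b
    rw [Fin.sum_univ_succAbove _ j, Fin.sum_univ_succAbove _ j, hf, hg] at hb
    simp only [Matrix.vecMul, dotProduct, Matrix.of_apply, Pi.zero_apply, sub_mul,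
      Finset.sum_sub_distrib]
    linarith
  have hz := Matrix.eq_zero_of_vecMul_eq_zero hdet key
  funext i
  rcases Fin.eq_self_or_eq_succAbove j i with rfl | ⟨a, rfl⟩
  · rw [hf, hg]
  · exact sub_eq_zero.mp (congrFun hz a)

/-- **Line of representations.** Fix `k` with `D k ≠ 0` and let `α` be the Cramer coordinate
vector of `Q` omitting `k` (extended by `α k = 0`), `l i = (-1)^i D i` the dependence. Then for
every `j` with `D j ≠ 0` the Cramer coordinates omitting `j` are `α - (α j / l j) • l`
(both represent `Q` with vanishing `j`-th coefficient; uniqueness). [folklore] -/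
theorem circuit_line (v : Fin 5 → Fin 4 → ℝ) (Q : Fin 4 → ℝ) (D : Fin 5 → ℝ)
    (E : Fin 5 → Fin 4 → ℝ)
    (hD : ∀ j, D j = (Matrix.of fun a b => v (j.succAbove a) b).det)
    (hE : ∀ j a, E j a = ((Matrix.of fun a' b => v (j.succAbove a') b).updateRow a Q).det)
    {l α : Fin 5 → ℝ} (hl : ∀ i, l i = (-1 : ℝ) ^ (i : ℕ) * D i)
    {k : Fin 5} (hk : D k ≠ 0) (hαk : α k = 0) (hαs : ∀ a, α (k.succAbove a) = E k a / D k)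
    {j : Fin 5} (hj : D j ≠ 0) (a' : Fin 4) :
    E j a' / D j = α (j.succAbove a') - α j / l j * l (j.succAbove a') := by
  have hlj : l j ≠ 0 := by
    rw [hl]
    exact mul_ne_zero (pow_ne_zero _ (by norm_num)) hj
  have hQα : ∀ b, Q b = ∑ i, α i * v i b := by
    intro b
    rw [Fin.sum_univ_succAbove _ k, hαk, zero_mul, zero_add, circuit_cramer v Q D E hD hE hk b]
    exact Finset.sum_congr rfl fun a _ => by rw [hαs]
  have hdep : ∀ b, ∑ i, l i * v i b = 0 := by
    intro b
    have := circuit_dependence v b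
    simp only [← hD] at this
    simpa only [hl] using this
  have hcg := circuit_unique v D hD hj (f := Fin.insertNth j (0 : ℝ) (fun a => E j a / D j))
    (g := fun i => α i - α j / l j * l i) (by simp) (by simp [div_mul_cancel₀ _ hlj]) (by
      intro b
      rw [Fin.sum_univ_succAbove _ j]
      simp only [Fin.insertNth_apply_same, Fin.insertNth_apply_succAbove, zero_mul, zero_add,
        sub_mul, Finset.sum_sub_distrib]
      rw [← circuit_cramer v Q D E hD hE hj b, ← hQα b]
      have : ∑ i, α j / l j * l i * v i b = α j / l j * ∑ i, l i * v i b := by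
        rw [Finset.mul_sum]
        exact Finset.sum_congr rfl fun i _ => by ring
      rw [this, hdep, mul_zero, sub_zero])
  have := congrFun hcg (j.succAbove a')
  simpa only [Fin.insertNth_apply_succAbove] using this

/-! ## The combinatorial core: strict extrema along the line of representations -/

/-- Sign bookkeeping for a Cramer coordinate at an index with `l i > 0`. [folklore] -/
theorem coord_pos_iff_of_pos {li lj ai aj : ℝ} (hi : 0 < li) :
    0 < ai - aj / lj * li ↔ aj / lj < ai / li := by
  have hli : li ≠ 0 := hi.ne'
  have h : ai - aj / lj * li = li * (ai / li - aj / lj) := by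
    generalize aj / lj = q
    field_simp
  rw [h, mul_pos_iff_of_pos_left hi, sub_pos]

/-- Sign bookkeeping for a Cramer coordinate at an index with `l i < 0`. [folklore] -/
theorem coord_pos_iff_of_neg {li lj ai aj : ℝ} (hi : li < 0) :
    0 < ai - aj / lj * li ↔ ai / li < aj / lj := by
  have hli : li ≠ 0 := hi.ne
  have h : ai - aj / lj * li = (-li) * (aj / lj - ai / li) := by
    generalize aj / lj = q
    field_simp
    ring
  rw [h, mul_pos_iff_of_pos_left (neg_pos.mpr hi), sub_pos]

/-- A nonzero Cramer coordinate separates the two ratios `a i / l i`, `a j / l j`. [folklore] -/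
theorem ratio_ne_of_coord_ne {li lj ai aj : ℝ} (hi : li ≠ 0) (h : ai - aj / lj * li ≠ 0) :
    ai / li ≠ aj / lj := by
  intro heq
  apply h
  have h' : ai - aj / lj * li = li * (ai / li - aj / lj) := by
    generalize aj / lj = q at heq ⊢
    field_simp
  rw [h', heq, sub_self, mul_zero]

/-- The hit condition is invariant under `l ↦ -l`. [folklore] -/
theorem coord_neg_neg (l a : Fin 5 → ℝ) (i j : Fin 5) :
    a i - a j / (-l) j * (-l) i = a i - a j / l j * l i := by
  simp only [Pi.neg_apply, div_neg, neg_mul_neg]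

/-- Among the indices with `l j > 0` at most one is a hit (two hits would be strictly below each
other). [folklore] -/
theorem hit_unique_pos (l a : Fin 5 → ℝ) {j j' : Fin 5} (hj : 0 < l j) (hj' : 0 < l j')
    (hc : ∀ i, i ≠ j → 0 < a i - a j / l j * l i)
    (hc' : ∀ i, i ≠ j' → 0 < a i - a j' / l j' * l i) : j = j' := by
  by_contra hne
  have h1 := (coord_pos_iff_of_pos hj').mp (hc j' (Ne.symm hne))
  have h2 := (coord_pos_iff_of_pos hj).mp (hc' j hne)
  exact lt_asymm h1 h2

/-- Among the indices with `l j < 0` at most one is a hit. [folklore] -/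
theorem hit_unique_neg (l a : Fin 5 → ℝ) {j j' : Fin 5} (hj : l j < 0) (hj' : l j' < 0)
    (hc : ∀ i, i ≠ j → 0 < a i - a j / l j * l i)
    (hc' : ∀ i, i ≠ j' → 0 < a i - a j' / l j' * l i) : j = j' :=
  hit_unique_pos (-l) a (j := j) (j' := j') (by simpa using hj) (by simpa using hj')
    (fun i hi => by rw [coord_neg_neg]; exact hc i hi)
    (fun i hi => by rw [coord_neg_neg]; exact hc' i hi)

/-- A hit with `l j > 0` produces a hit with `l m < 0`: the strict argmax of `a / l` over the
negative indices (transitivity along the line). [folklore] -/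
theorem hit_pos_to_neg (l a : Fin 5 → ℝ) (hneg : ∃ j, l j < 0)
    (hgen : ∀ i j, i ≠ j → l i ≠ 0 → l j ≠ 0 → a i - a j / l j * l i ≠ 0)
    {j : Fin 5} (hj : 0 < l j) (hc : ∀ i, i ≠ j → 0 < a i - a j / l j * l i) :
    ∃ m, l m < 0 ∧ ∀ i, i ≠ m → 0 < a i - a m / l m * l i := by
  classical
  obtain ⟨m, hmN, hmax⟩ := Finset.exists_max_image (Finset.univ.filter fun i => l i < 0)
    (fun i => a i / l i) (by obtain ⟨i, hi⟩ := hneg; exact ⟨i, by simpa using hi⟩)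
  have hm : l m < 0 := by simpa using hmN
  have hmj : m ≠ j := fun h => by
    rw [h] at hm
    exact lt_asymm hm hj
  have hjm : a m / l m < a j / l j := (coord_pos_iff_of_neg hm).mp (hc m hmj)
  refine ⟨m, hm, fun i hi => ?_⟩
  rcases lt_trichotomy (l i) 0 with hli | hli | hli
  · have hle : a i / l i ≤ a m / l m := hmax i (by simpa using hli)
    have hne : a i / l i ≠ a m / l m := ratio_ne_of_coord_ne hli.ne (hgen i m hi hli.ne hm.ne)
    exact (coord_pos_iff_of_neg hli).mpr (lt_of_le_of_ne hle hne)
  · have hij : i ≠ j := fun h => by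
      rw [h] at hli
      exact hj.ne' hli
    have h0 := hc i hij
    rw [hli, mul_zero, sub_zero] at h0
    rw [hli, mul_zero, sub_zero]
    exact h0
  · refine (coord_pos_iff_of_pos hli).mpr ?_
    by_cases hij : i = j
    · rw [hij]
      exact hjm
    · exact hjm.trans ((coord_pos_iff_of_pos hli).mp (hc i hij))

/-- A hit with `l m < 0` produces a hit with `l j > 0` (the previous lemma for `-l`).
[folklore] -/
theorem hit_neg_to_pos (l a : Fin 5 → ℝ) (hpos : ∃ j, 0 < l j)
    (hgen : ∀ i j, i ≠ j → l i ≠ 0 → l j ≠ 0 → a i - a j / l j * l i ≠ 0)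
    {m : Fin 5} (hm : l m < 0) (hc : ∀ i, i ≠ m → 0 < a i - a m / l m * l i) :
    ∃ j, 0 < l j ∧ ∀ i, i ≠ j → 0 < a i - a j / l j * l i := by
  obtain ⟨j, hj, hcj⟩ := hit_pos_to_neg (-l) a
    (by obtain ⟨i, hi⟩ := hpos; exact ⟨i, by simpa using hi⟩)
    (fun i j hij hi hj => by
      rw [coord_neg_neg]
      exact hgen i j hij (by simpa using hi) (by simpa using hj))
    (j := m) (by simpa using hm) (fun i hi => by rw [coord_neg_neg]; exact hc i hi)
  exact ⟨j, by simpa using hj, fun i hi => by rw [← coord_neg_neg l a i j]; exact hcj i hi⟩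

/-- **Counting.** Under both signs and genericity the signed count of hits vanishes: at most one
positive and at most one negative hit, and one exists iff the other does. [folklore] -/
theorem circuit_count (l a : Fin 5 → ℝ) (hpos : ∃ j, 0 < l j) (hneg : ∃ j, l j < 0)
    (hgen : ∀ i j, i ≠ j → l i ≠ 0 → l j ≠ 0 → a i - a j / l j * l i ≠ 0) :
    ∑ j, Real.sign (l j) * (if ∀ i, i ≠ j → 0 < a i - a j / l j * l i then (1 : ℝ) else 0)
      = 0 := by
  classical
  by_cases h : ∃ j, 0 < l j ∧ ∀ i, i ≠ j → 0 < a i - a j / l j * l i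
  · obtain ⟨j, hj, hcj⟩ := h
    obtain ⟨m, hm, hcm⟩ := hit_pos_to_neg l a hneg hgen hj hcj
    have hjm : j ≠ m := fun h => by
      rw [h] at hj
      exact lt_asymm hj hm
    rw [Fintype.sum_eq_add j m hjm]
    · rw [if_pos hcj, if_pos hcm, Real.sign_of_pos hj, Real.sign_of_neg hm]
      norm_num
    · rintro x ⟨hxj, hxm⟩
      rcases lt_trichotomy (l x) 0 with hx | hx | hx
      · rw [if_neg (fun hcx => hxm (hit_unique_neg l a hx hm hcx hcm)), mul_zero]
      · rw [hx, Real.sign_zero, zero_mul]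
      · rw [if_neg (fun hcx => hxj (hit_unique_pos l a hx hj hcx hcj)), mul_zero]
  · have h' : ∀ j, 0 < l j → ¬ ∀ i, i ≠ j → 0 < a i - a j / l j * l i :=
      fun j hj hcj => h ⟨j, hj, hcj⟩
    refine Finset.sum_eq_zero fun x _ => ?_
    rcases lt_trichotomy (l x) 0 with hx | hx | hx
    · have hnc : ¬ ∀ i, i ≠ x → 0 < a i - a x / l x * l i := fun hcx => by
        obtain ⟨j, hj, hcj⟩ := hit_neg_to_pos l a hpos hgen hx hcx
        exact h' j hj hcj
      rw [if_neg hnc, mul_zero]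
    · rw [hx, Real.sign_zero, zero_mul]
    · rw [if_neg (h' x hx), mul_zero]

/-! ## Assembly -/

/-- `0 < d * e ↔ 0 < e / d`. [folklore] -/
theorem mul_pos_iff_div_pos (d e : ℝ) : 0 < d * e ↔ 0 < e / d := by
  rw [mul_pos_iff, div_pos_iff]
  tauto

/-- `(-1)^n · sign d = sign ((-1)^n d)`. [folklore] -/
theorem neg_one_pow_mul_sign (n : ℕ) (d : ℝ) :
    (-1 : ℝ) ^ n * Real.sign d = Real.sign ((-1 : ℝ) ^ n * d) := by
  rcases neg_one_pow_eq_or ℝ n with h | h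
  · rw [h, one_mul, one_mul]
  · rw [h, neg_one_mul, neg_one_mul, Real.sign_neg]

/-- Termwise identification of the determinant-form summand with the line-form summand.
[folklore] -/
theorem circuit_summand (D : Fin 5 → ℝ) (E : Fin 5 → Fin 4 → ℝ) {l α : Fin 5 → ℝ}
    (hl : ∀ i, l i = (-1 : ℝ) ^ (i : ℕ) * D i)
    (hid : ∀ j, D j ≠ 0 → ∀ a',
      E j a' / D j = α (j.succAbove a') - α j / l j * l (j.succAbove a'))
    (j : Fin 5) :
    (-1 : ℝ) ^ (j : ℕ) * Real.sign (D j) * (if ∀ a, 0 < D j * E j a then (1 : ℝ) else 0)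
      = Real.sign (l j) *
        (if ∀ i, i ≠ j → 0 < α i - α j / l j * l i then (1 : ℝ) else 0) := by
  by_cases hj : D j = 0
  · rw [hl j, hj, mul_zero, Real.sign_zero, mul_zero, zero_mul, zero_mul]
  · have hiff : (∀ a, 0 < D j * E j a) ↔ ∀ i, i ≠ j → 0 < α i - α j / l j * l i := by
      constructor
      · intro h i hi
        obtain ⟨a', rfl⟩ := Fin.exists_succAbove_eq hi
        rw [← hid j hj a', ← mul_pos_iff_div_pos]
        exact h a'
      · intro h a'
        rw [mul_pos_iff_div_pos, hid j hj a']
        exact h _ (Fin.succAbove_ne j a')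
    have hs : (-1 : ℝ) ^ (j : ℕ) * Real.sign (D j) = Real.sign (l j) := by
      rw [hl j]
      exact neg_one_pow_mul_sign _ _
    rw [hs]
    by_cases hP : ∀ a, 0 < D j * E j a
    · rw [if_pos hP, if_pos (hiff.mp hP)]
    · rw [if_neg hP, if_neg (mt hiff.mpr hP)]

/-- Assembly over an abstract dependence `l` and base point `α` on the line. [folklore] -/
theorem circuit_of_line (D : Fin 5 → ℝ) (E : Fin 5 → Fin 4 → ℝ) {l α : Fin 5 → ℝ}
    (hl : ∀ i, l i = (-1 : ℝ) ^ (i : ℕ) * D i)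
    (hid : ∀ j, D j ≠ 0 → ∀ a',
      E j a' / D j = α (j.succAbove a') - α j / l j * l (j.succAbove a'))
    (hpos : ∃ j : Fin 5, 0 < (-1 : ℝ) ^ (j : ℕ) * D j)
    (hneg : ∃ j : Fin 5, (-1 : ℝ) ^ (j : ℕ) * D j < 0)
    (hgen : ∀ j a, D j ≠ 0 → D (j.succAbove a) ≠ 0 → E j a ≠ 0) :
    ∑ j : Fin 5, (-1 : ℝ) ^ (j : ℕ) * Real.sign (D j) *
      (if ∀ a, 0 < D j * E j a then (1 : ℝ) else 0) = 0 := by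
  have hDl : ∀ i, l i ≠ 0 → D i ≠ 0 := fun i hi hDi => hi (by rw [hl, hDi, mul_zero])
  have hgen' : ∀ i j, i ≠ j → l i ≠ 0 → l j ≠ 0 → α i - α j / l j * l i ≠ 0 := by
    intro i j hij hi hj
    obtain ⟨a', rfl⟩ := Fin.exists_succAbove_eq hij
    rw [← hid j (hDl j hj) a']
    exact div_ne_zero (hgen j a' (hDl j hj) (hDl _ hi)) (hDl j hj)
  have hpos' : ∃ j, 0 < l j := by
    obtain ⟨j, hj⟩ := hpos
    exact ⟨j, by rw [hl]; exact hj⟩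
  have hneg' : ∃ j, l j < 0 := by
    obtain ⟨j, hj⟩ := hneg
    exact ⟨j, by rw [hl]; exact hj⟩
  rw [Finset.sum_congr rfl fun j _ => circuit_summand D E hl hid j]
  exact circuit_count l α hpos' hneg' hgen'

/-- **Circuit lemma** (determinant / Cramer form). For five vectors `v₀,…,v₄ ∈ ℝ⁴` with signed
maximal minors `λ_j = (-1)^j D j` of both signs (the linear dependence `Σ λ_j v_j = 0`) and
generic Cramer coordinates, the signed count `Σ_j sign(λ_j) · [Q ∈ open cone of the vᵢ, i ≠ j]`
vanishes: all Cramer coordinate vectors of `Q` lie on one line `α + t • λ`, a positive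
(resp. negative) hit is a strict argmin (resp. the strict argmax below it) of `α/λ`, so hits come
in exactly one `±` pair or not at all. [folklore] -/
theorem stub_circuitCore :
    ∀ (v : Fin 5 → Fin 4 → ℝ) (Q : Fin 4 → ℝ) (D : Fin 5 → ℝ) (E : Fin 5 → Fin 4 → ℝ),
      (∀ j, D j = (Matrix.of fun a b => v (j.succAbove a) b).det) →
      (∀ j a, E j a = ((Matrix.of fun a' b => v (j.succAbove a') b).updateRow a Q).det) →
      (∃ j : Fin 5, 0 < (-1 : ℝ) ^ (j : ℕ) * D j) → (∃ j : Fin 5, (-1 : ℝ) ^ (j : ℕ) * D j < 0) →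
      (∀ j a, D j ≠ 0 → D (j.succAbove a) ≠ 0 → E j a ≠ 0) →
      ∑ j : Fin 5, (-1 : ℝ) ^ (j : ℕ) * Real.sign (D j) * (if ∀ a, 0 < D j * E j a then (1 : ℝ) else 0) = 0 := by
  intro v Q D E hD hE hpos hneg hgen
  obtain ⟨k, hk⟩ := id hpos
  have hDk : D k ≠ 0 := by
    intro h
    rw [h, mul_zero] at hk
    exact lt_irrefl _ hk
  exact circuit_of_line D E (l := fun i => (-1 : ℝ) ^ (i : ℕ) * D i)
    (α := Fin.insertNth k (0 : ℝ) (fun a => E k a / D k)) (fun _ => rfl)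
    (fun j hj a' =>
      circuit_line v Q D E hD hE (fun _ => rfl) hDk (by simp) (fun a => by simp) hj a')
    hpos hneg hgen

end Summit.KontsevichZagierPeriods.HyperbolicBloch.FiveTerm

end
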